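import Mathlib
import Literature.AlgebraicGeometry.Resolution.WeightedResolutionDatum
import Summits.ResolutionOfSingularities.ResolutionOfSingularities.Theorems.WeightedInvariantContactFiltrationCanonical
import Summits.ResolutionOfSingularities.ResolutionOfSingularities.Theorems.WeightedInvariantRegularSubschemeCentre
import HarnessLib

/-!
# (o25-α) support: Abramovich–Quek–Schober Thm 3.5 (a)(b)(c) at general weights — the filtration of a weighted centre with `w₁ ≤ w₀`
# does not depend on the transversal parameter, and two admissible regular systems at the same `(w, ℓ)` define the SAME filtration

Topic: `Summits/ResolutionOfSingularities/ResolutionOfSingularities/Theorems`. Helper for the door item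
`HypersurfaceCentreConstruction` (statement `stmt-ResolutionOfSingularities-19897`, route `WeightedInvariant`), ORDER (o25)
«F-AQS-T in the kernel» (lead res-type-092, design memo `plan/tools/res-type-092/o25/O25-DESIGN.md`; (o25-α) support by the
co-hand res-type-070, INPUT #2 HOME/STATUS 2026-08-27T09:37Z).  Def-free; the tree's currency for the centre `(y^{a₁}, x^{a₂})` with
reduced weights `(w 0, w 1)`, `w 1 ≤ w 0`, is `weightedMonomialIdeal ![y, x] w n` (index `0` = the ORDER / contact parameter).

* (U1) `weightedMonomialIdeal_pair_le_of_mem_span`, `weightedMonomialIdeal_pair_eq_of_span_eq` — for `w 1 ≤ w 0` the filtration does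
  not depend on the transversal parameter: `(x₀, x₁) = (x₀, z)` ⇒ equal filtrations (expand `x₁ = a x₀ + c z` binomially; the weight only
  grows).  Generalises res-type-078's C1 (`ContactFiltration.weightedMonomialIdeal_eq_contactFiltration`, slope `w = (b, 1)`).
* (U2) `mem_span_sup_pow_of_mem_weightedMonomialIdeal` — THE KEY STEP AT WEIGHTS (C2's `mem_span_sup_pow_of_mem_contactFiltration`
  re-run with rational slope `s = w 0 / w 1 > 1`): in a regular local ring, if `f ∉ 𝔪^{ν+1}` is admissible at the level `ℓ = w 0 · ν` for
  both `(g₁, x₁)` and `(g₂, x₂)` (`gᵢ, xᵢ ∈ 𝔪`, `g₂ ∉ 𝔪²`) then `g₁ ∈ (g₂) + 𝔪^m` for every `m` with `w 1 (m − 1) < w 0` — the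
  discrete-valuation argument in `S/(g₂)` (AQS Thm 3.5 proof (b), without monomial valuations or unit expansions).
* (U3) `weightedMonomialIdeal_le_of_mem_span_sup_pow` — `g₁ ∈ (g₂) + 𝔪^m` with `w 0 ≤ w 1 m` and `x₁ ∈ 𝔪 = (g₂, x₂)` ⇒
  `𝒥((g₁, x₁)) ≤ 𝒥((g₂, x₂))` (multiplicativity `weightedMonomialIdeal_mul_le`).
* **`weightedMonomialIdeal_eq_of_admissible`** — AQS Thm 3.5 proof (c): two regular systems of parameters both admissible at the same
  `(w, w 0 · ν)` with `0 < w 1 < w 0` define the SAME filtration in every degree = clause 9 (UNIQUE) of `IsLexMaxWeightedCentreGerm`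
  (`Literature/…/HypersurfaceHeightTwoWeightedCentre.lean`); no lex-maximality is needed.  (Slope `1`, i.e. `w = (1,1)` after reduction,
  is the `𝔪`-adic filtration — independent of the parameters outright.)

[OURS · L1 W4.3] Replaces the role of NO printed item; NOT a statement of the manuscript
[claim: Hironaka2017, status: under-review]. AI work, weaker than expert review.
-/

noncomputable section

open IsLocalRing Literature.AlgebraicGeometry.Resolution

set_option linter.dupNamespace false -- mandated namespace of this single-conjunct summit

namespace Summit.ResolutionOfSingularities.ResolutionOfSingularities.Theorems

namespace AQSHeightTwo

universe u

variable {S : Type u} [CommRing S]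

/-- The monomial `x₀^i z^j` lies in `weightedMonomialIdeal ![x₀, z] w n` as soon as `w 0 i + w 1 j ≥ n`. [folklore] -/
theorem pow_mul_pow_mem_weightedMonomialIdeal (x₀ z : S) (w : Fin 2 → ℕ) {i j n : ℕ} (h : n ≤ w 0 * i + w 1 * j) :
    x₀ ^ i * z ^ j ∈ weightedMonomialIdeal ![x₀, z] w n := by
  refine Ideal.subset_span ⟨![i, j], ?_, ?_⟩
  · simpa [Fin.sum_univ_two] using h
  · simp [Fin.prod_univ_two]

/-- **(U1) Transversal independence, one inclusion**: if `w 1 ≤ w 0` and `x₁ ∈ (x₀, z)` then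
`weightedMonomialIdeal ![x₀, x₁] w n ≤ weightedMonomialIdeal ![x₀, z] w n` (write `x₁ = a x₀ + c z` and expand binomially:
`x₀^{α₀} x₁^{α₁}` is a combination of `x₀^{α₀ + k} z^{α₁ - k}`, of weight `w 0 (α₀ + k) + w 1 (α₁ - k) ≥ w 0 α₀ + w 1 α₁`).
[cite: AbramovichQuekSchober2025, Thm 3.5 proof (a)] -/
theorem weightedMonomialIdeal_pair_le_of_mem_span (x₀ x₁ z : S) (w : Fin 2 → ℕ) (hw : w 1 ≤ w 0)
    (hx₁ : x₁ ∈ Ideal.span {x₀, z}) (n : ℕ) :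
    weightedMonomialIdeal ![x₀, x₁] w n ≤ weightedMonomialIdeal ![x₀, z] w n := by
  classical
  obtain ⟨a, c, hac⟩ := Ideal.mem_span_pair.mp hx₁
  rw [weightedMonomialIdeal, Ideal.span_le]
  rintro _ ⟨α, hα, rfl⟩
  rw [Fin.sum_univ_two] at hα
  simp only [SetLike.mem_coe, Fin.prod_univ_two, Matrix.cons_val_zero, Matrix.cons_val_one]
  rw [← hac, add_pow, Finset.mul_sum]
  refine Ideal.sum_mem _ fun k hk => ?_
  have hkle : k ≤ α 1 := Nat.lt_succ_iff.mp (Finset.mem_range.mp hk)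
  have hmem : x₀ ^ (α 0 + k) * z ^ (α 1 - k) ∈ weightedMonomialIdeal ![x₀, z] w n :=
    pow_mul_pow_mem_weightedMonomialIdeal x₀ z w (by
      have h1 : w 1 * (α 1 - k) + w 1 * k = w 1 * α 1 := by rw [← Nat.mul_add, Nat.sub_add_cancel hkle]
      have h2 : w 1 * k ≤ w 0 * k := Nat.mul_le_mul_right k hw
      nlinarith [hα, h1, h2])
  have heq : x₀ ^ α 0 * ((a * x₀) ^ k * (c * z) ^ (α 1 - k) * ((α 1).choose k : S)) =
      (a ^ k * c ^ (α 1 - k) * ((α 1).choose k : S)) * (x₀ ^ (α 0 + k) * z ^ (α 1 - k)) := by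
    rw [mul_pow, mul_pow, pow_add]; ring
  rw [heq]
  exact Ideal.mul_mem_left _ _ hmem

/-- **(U1) The filtration of a weighted centre with `w 1 ≤ w 0` depends only on the contact parameter**: if
`(x₀, x₁) = (x₀, z)` as ideals then `weightedMonomialIdeal ![x₀, x₁] w = weightedMonomialIdeal ![x₀, z] w`.
[cite: AbramovichQuekSchober2025, Thm 3.5 proof (a)] -/
theorem weightedMonomialIdeal_pair_eq_of_span_eq (x₀ x₁ z : S) (w : Fin 2 → ℕ) (hw : w 1 ≤ w 0)
    (h : Ideal.span {x₀, x₁} = Ideal.span {x₀, z}) (n : ℕ) :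
    weightedMonomialIdeal ![x₀, x₁] w n = weightedMonomialIdeal ![x₀, z] w n :=
  le_antisymm
    (weightedMonomialIdeal_pair_le_of_mem_span x₀ x₁ z w hw (h ▸ Ideal.subset_span (by simp)) n)
    (weightedMonomialIdeal_pair_le_of_mem_span x₀ z x₁ w hw (h.symm ▸ Ideal.subset_span (by simp)) n)

/-! ### (U2) The key step at weights: two contact parameters admissible at the same `(w, ℓ)` are congruent mod `𝔪^⌈w₀/w₁⌉` -/

section KeyStep

variable [IsRegularLocalRing S]

/-- **(U2) Key step at weights** (res-type-078's C2 `ContactFiltration.mem_span_sup_pow_of_mem_contactFiltration` re-run with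
rational slope `s = w 0 / w 1 > 1`).  `S` regular local, `g₁, x₁, g₂, x₂ ∈ 𝔪` with `g₂ ∉ 𝔪²`, `w 1 < w 0`, `1 ≤ ν`,
`f ∉ 𝔪^{ν+1}`, and `f` admissible for BOTH weighted data at the level `ℓ = w 0 · ν`:
`f ∈ weightedMonomialIdeal ![g₁, x₁] w ℓ` and `f ∈ weightedMonomialIdeal ![g₂, x₂] w ℓ`.  Then `g₁ ∈ (g₂) + 𝔪^m` for every `m`
with `w 1 (m − 1) < w 0` (i.e. `m ≤ ⌈s⌉`).  Proof in the discrete valuation ring `D = S/(g₂)`: the coefficient `c` of `g₁^ν` is a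
unit (`s > 1`), `f̄ ∈ 𝔪_D^{i}` with `w 1 i ≥ ℓ`, and if `t = ord_D(ḡ₁)` has `w 1 t < w 0` every other term has order `> ν t` —
impossible. [cite: AbramovichQuekSchober2025, Thm 3.5 proof (b)] -/
theorem mem_span_sup_pow_of_mem_weightedMonomialIdeal {g₁ x₁ g₂ x₂ : S} (hg₁ : g₁ ∈ maximalIdeal S)
    (hx₁ : x₁ ∈ maximalIdeal S) (hg₂ : g₂ ∈ maximalIdeal S) (hg₂' : g₂ ∉ maximalIdeal S ^ 2) (hx₂ : x₂ ∈ maximalIdeal S)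
    (w : Fin 2 → ℕ) (hs : w 1 < w 0) {f : S} {ν : ℕ} (hν : 1 ≤ ν)
    (hford : f ∉ maximalIdeal S ^ (ν + 1)) (h₁ : f ∈ weightedMonomialIdeal ![g₁, x₁] w (w 0 * ν))
    (h₂ : f ∈ weightedMonomialIdeal ![g₂, x₂] w (w 0 * ν)) {m : ℕ} (hm : w 1 * (m - 1) < w 0) :
    g₁ ∈ Ideal.span {g₂} ⊔ maximalIdeal S ^ m := by
  classical
  -- the quotient `D = S/(g₂)`, a regular local ring
  haveI hD : IsRegularLocalRing (S ⧸ Ideal.span {g₂}) := (IsRegularLocalRing.quotient_span_singleton hg₂ hg₂').1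
  set mk : S →+* S ⧸ Ideal.span {g₂} := Ideal.Quotient.mk (Ideal.span {g₂}) with hmk
  have hmkmax : (maximalIdeal S).map mk = maximalIdeal (S ⧸ Ideal.span {g₂}) :=
    IsLocalRing.map_maximalIdeal_of_surjective mk Ideal.Quotient.mk_surjective
  have hcomap : ∀ k : ℕ, (maximalIdeal (S ⧸ Ideal.span {g₂}) ^ k).comap mk = Ideal.span {g₂} ⊔ maximalIdeal S ^ k :=
    fun k => by
      rw [← hmkmax, ← Ideal.map_pow, Ideal.comap_map_of_surjective mk Ideal.Quotient.mk_surjective,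
        ← RingHom.ker_eq_comap_bot, hmk, Ideal.mk_ker, sup_comm]
  -- if `g₁ ∈ (g₂)` we are done
  by_cases hzero : mk g₁ = 0
  · rw [Ideal.Quotient.eq_zero_iff_mem] at hzero
    exact Ideal.mem_sup_left hzero
  -- the order `t` of `ḡ₁`
  obtain ⟨t, ht⟩ := ENat.ne_top_iff_exists.mp (adicOrder_ne_top hzero)
  have htmem : mk g₁ ∈ maximalIdeal (S ⧸ Ideal.span {g₂}) ^ t := (le_adicOrder_iff _ _).mp ht.le
  have htnot : mk g₁ ∉ maximalIdeal (S ⧸ Ideal.span {g₂}) ^ (t + 1) := (adicOrder_le_iff _ _).mp ht.ge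
  by_cases htb : w 0 ≤ w 1 * t
  · -- `t ≥ s`, hence `t ≥ m`
    have hmt : m ≤ t := by
      by_contra hlt
      push Not at hlt
      have : w 1 * t ≤ w 1 * (m - 1) := Nat.mul_le_mul_left _ (by omega)
      omega
    rw [← hcomap m, Ideal.mem_comap]
    exact Ideal.pow_le_pow_right hmt htmem
  exfalso
  push Not at htb
  -- `f = c g₁^ν + f'`, `f'` in the lower pieces `I'`
  set I' : Ideal S := (⨆ j, ⨆ (_ : j < ν), ⨆ i, ⨆ (_ : w 0 * ν ≤ w 0 * j + w 1 * i),
      Ideal.span {g₁ ^ j * x₁ ^ i}) ⊔ Ideal.span {g₁ ^ ν} * maximalIdeal S with hI'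
  have hsplit : weightedMonomialIdeal ![g₁, x₁] w (w 0 * ν) ≤ Ideal.span {g₁ ^ ν} ⊔ I' := by
    rw [weightedMonomialIdeal, Ideal.span_le]
    rintro _ ⟨α, hα, rfl⟩
    rw [Fin.sum_univ_two] at hα
    simp only [SetLike.mem_coe, Fin.prod_univ_two, Matrix.cons_val_zero, Matrix.cons_val_one]
    rcases Nat.lt_trichotomy (α 0) ν with hlt | heq | hgt
    · -- `j < ν`: a lower piece
      refine Ideal.mem_sup_right ?_
      rw [hI']
      refine Ideal.mem_sup_left ?_
      refine Ideal.mem_iSup_of_mem (α 0) (Ideal.mem_iSup_of_mem hlt (Ideal.mem_iSup_of_mem (α 1)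
        (Ideal.mem_iSup_of_mem hα (Ideal.mem_span_singleton_self _))))
    · -- `j = ν`: `x₁^i` with `i = 0` (the top coefficient) or `i ≥ 1`
      rcases Nat.eq_zero_or_pos (α 1) with hi | hi
      · rw [heq, hi, pow_zero, mul_one]
        exact Ideal.mem_sup_left (Ideal.mem_span_singleton_self _)
      · refine Ideal.mem_sup_right ?_
        rw [hI', heq]
        refine Ideal.mem_sup_right (Ideal.mul_mem_mul (Ideal.mem_span_singleton_self _) ?_)
        exact Ideal.pow_mem_of_mem _ hx₁ _ hi
    · -- `j > ν`: a multiple of `g₁^{ν+1} ∈ (g₁^ν) 𝔪`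
      refine Ideal.mem_sup_right ?_
      rw [hI']
      refine Ideal.mem_sup_right (Ideal.mul_mem_right _ _ ?_)
      obtain ⟨d, hd⟩ := Nat.exists_eq_add_of_lt hgt
      rw [hd, show ν + d + 1 = ν + (d + 1) by ring, pow_add]
      exact Ideal.mul_mem_mul (Ideal.mem_span_singleton_self _) (Ideal.pow_mem_of_mem _ hg₁ _ (Nat.succ_pos d))
  -- the lower pieces lie in `𝔪^{ν+1}` (this uses `s > 1`)
  have hI'le : I' ≤ maximalIdeal S ^ (ν + 1) := by
    rw [hI']
    refine sup_le (iSup_le fun j => iSup_le fun hj => iSup_le fun i => iSup_le fun hji => ?_) ?_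
    · rw [Ideal.span_singleton_le_iff_mem]
      have h1 : g₁ ^ j * x₁ ^ i ∈ maximalIdeal S ^ (j + i) := by
        rw [pow_add]; exact Ideal.mul_mem_mul (Ideal.pow_mem_pow hg₁ j) (Ideal.pow_mem_pow hx₁ i)
      refine Ideal.pow_le_pow_right ?_ h1
      -- `w 1 i ≥ w 0 (ν - j) > w 1 (ν - j)` ⇒ `i ≥ ν - j + 1`
      have h2 : w 0 * (ν - j) ≤ w 1 * i := by rw [Nat.mul_sub]; omega
      have h3 : w 1 * (ν - j) < w 0 * (ν - j) := Nat.mul_lt_mul_of_pos_right hs (by omega)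
      have h4 : ν - j < i := by
        by_contra hle
        push Not at hle
        have := Nat.mul_le_mul_left (w 1) hle
        omega
      omega
    · have h1 : Ideal.span {g₁ ^ ν} ≤ maximalIdeal S ^ ν := by
        rw [Ideal.span_singleton_le_iff_mem]; exact Ideal.pow_mem_pow hg₁ ν
      refine le_trans (Ideal.mul_mono_left h1) ?_
      rw [pow_succ]
  obtain ⟨a, ha, f', hf', haf⟩ := Submodule.mem_sup.mp (hsplit h₁)
  obtain ⟨c, rfl⟩ := Ideal.mem_span_singleton'.mp ha
  -- `c` is a unit
  have hc : IsUnit c := by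
    by_contra hcu
    have hcm : c ∈ maximalIdeal S := (IsLocalRing.mem_maximalIdeal _).mpr hcu
    apply hford
    rw [← haf]
    refine Ideal.add_mem _ ?_ (hI'le hf')
    have : c * g₁ ^ ν ∈ Ideal.span {g₁ ^ ν} * maximalIdeal S :=
      Submodule.mul_mem_mul_rev (Ideal.mem_span_singleton_self _) hcm
    exact hI'le (by rw [hI']; exact Ideal.mem_sup_right this)
  -- in `D`: `f̄ ∈ 𝔪_D^{νt+1}`
  have hfD : mk f ∈ maximalIdeal (S ⧸ Ideal.span {g₂}) ^ (ν * t + 1) := by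
    have hle : weightedMonomialIdeal ![g₂, x₂] w (w 0 * ν) ≤ (maximalIdeal (S ⧸ Ideal.span {g₂}) ^ (ν * t + 1)).comap mk := by
      rw [weightedMonomialIdeal, Ideal.span_le]
      rintro _ ⟨α, hα, rfl⟩
      rw [Fin.sum_univ_two] at hα
      simp only [SetLike.mem_coe, Ideal.mem_comap, Fin.prod_univ_two, Matrix.cons_val_zero, Matrix.cons_val_one,
        map_mul, map_pow]
      rcases Nat.eq_zero_or_pos (α 0) with h0 | h0
      · -- pure power of `x₂`: `w 1 α₁ ≥ w 0 ν > w 1 t ν` ⇒ `α₁ ≥ ν t + 1`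
        rw [h0, pow_zero, one_mul]
        have h1 : ν * t < α 1 := by
          by_contra hle
          push Not at hle
          have e1 : w 1 * α 1 ≤ w 1 * (ν * t) := Nat.mul_le_mul_left _ hle
          have e2 : w 1 * (ν * t) = (w 1 * t) * ν := by ring
          have e3 : (w 1 * t) * ν < w 0 * ν := Nat.mul_lt_mul_of_pos_right htb (by omega)
          rw [h0, mul_zero, zero_add] at hα
          omega
        refine Ideal.pow_le_pow_right h1 (Ideal.pow_mem_pow ?_ _)
        rw [← hmkmax]; exact Ideal.mem_map_of_mem mk hx₂
      · -- a multiple of `ḡ₂ = 0`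
        have : mk g₂ ^ α 0 = 0 := by
          rw [hmk, Ideal.Quotient.eq_zero_iff_mem.mpr (Ideal.mem_span_singleton_self g₂), zero_pow h0.ne']
        rw [this, zero_mul]
        exact Ideal.zero_mem _
    exact hle h₂
  -- in `D`: `f̄' ∈ 𝔪_D^{νt+1}`
  have hmkx₁ : mk x₁ ∈ maximalIdeal (S ⧸ Ideal.span {g₂}) := by rw [← hmkmax]; exact Ideal.mem_map_of_mem mk hx₁
  have hI'D : I'.map mk ≤ maximalIdeal (S ⧸ Ideal.span {g₂}) ^ (ν * t + 1) := by
    rw [hI', Ideal.map_sup, Ideal.map_iSup]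
    refine sup_le (iSup_le fun j => ?_) ?_
    · rw [Ideal.map_iSup]
      refine iSup_le fun hj => ?_
      rw [Ideal.map_iSup]
      refine iSup_le fun i => ?_
      rw [Ideal.map_iSup]
      refine iSup_le fun hji => ?_
      rw [Ideal.map_span, Set.image_singleton, map_mul, map_pow, map_pow, Ideal.span_singleton_le_iff_mem]
      have h1 : mk g₁ ^ j * mk x₁ ^ i ∈ maximalIdeal (S ⧸ Ideal.span {g₂}) ^ (t * j + i) := by
        rw [pow_add, pow_mul]
        exact Ideal.mul_mem_mul (Ideal.pow_mem_pow htmem j) (Ideal.pow_mem_pow hmkx₁ i)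
      refine Ideal.pow_le_pow_right ?_ h1
      -- `w 1 i ≥ w 0 (ν - j) > w 1 t (ν - j)` ⇒ `i ≥ t (ν - j) + 1`
      have h2 : w 0 * (ν - j) ≤ w 1 * i := by rw [Nat.mul_sub]; omega
      have h3 : (w 1 * t) * (ν - j) < w 0 * (ν - j) := Nat.mul_lt_mul_of_pos_right htb (by omega)
      have h4 : t * (ν - j) < i := by
        by_contra hle
        push Not at hle
        have e1 : w 1 * i ≤ w 1 * (t * (ν - j)) := Nat.mul_le_mul_left _ hle
        have e2 : w 1 * (t * (ν - j)) = (w 1 * t) * (ν - j) := by ring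
        omega
      have h5 : t * j + t * (ν - j) = t * ν := by rw [← Nat.mul_add, Nat.add_sub_cancel' hj.le]
      have h6 : ν * t = t * ν := Nat.mul_comm _ _
      omega
    · rw [Ideal.map_mul, hmkmax, Ideal.map_span, Set.image_singleton, map_pow, pow_succ]
      refine Ideal.mul_mono_left ?_
      rw [Ideal.span_singleton_le_iff_mem, Nat.mul_comm, pow_mul]
      exact Ideal.pow_mem_pow htmem ν
  have hcg : mk (c * g₁ ^ ν) ∈ maximalIdeal (S ⧸ Ideal.span {g₂}) ^ (ν * t + 1) := by
    have : mk (c * g₁ ^ ν) = mk f - mk f' := by rw [← haf, map_add, add_sub_cancel_right]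
    rw [this]
    exact Ideal.sub_mem _ hfD (hI'D (Ideal.mem_map_of_mem mk hf'))
  have hgν : mk g₁ ^ ν ∈ maximalIdeal (S ⧸ Ideal.span {g₂}) ^ (ν * t + 1) := by
    rw [map_mul, map_pow] at hcg
    obtain ⟨u, hu⟩ := hc.map mk
    have := Ideal.mul_mem_left _ (↑u⁻¹ : S ⧸ Ideal.span {g₂}) hcg
    rwa [← mul_assoc, ← hu, Units.inv_mul, one_mul] at this
  exact ContactFiltration.pow_not_mem_pow_of_not_mem_pow htnot ν hgν

end KeyStep

/-! ### (U3) Equality of the two filtrations -/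

/-- `𝔪^d ≤ weightedMonomialIdeal ![g, x] w (w 1 · d)` when `(g, x) = 𝔪` and `w 1 ≤ w 0` (every monomial of degree `d` has weight
`≥ w 1 d`). [folklore] -/
theorem maximalIdeal_pow_le_weightedMonomialIdeal_mul [IsLocalRing S] {g x : S} (hspan : Ideal.span {g, x} = maximalIdeal S)
    (w : Fin 2 → ℕ) (hw : w 1 ≤ w 0) (d : ℕ) :
    maximalIdeal S ^ d ≤ weightedMonomialIdeal ![g, x] w (w 1 * d) := by
  induction d with
  | zero => rw [mul_zero, weightedMonomialIdeal_zero]; exact le_top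
  | succ d ih =>
    rw [pow_succ, Nat.mul_succ]
    refine le_trans (Ideal.mul_mono ih ?_) (weightedMonomialIdeal_mul_le _ w _ _)
    rw [← hspan, Ideal.span_le]
    intro y hy
    have hg : g ∈ weightedMonomialIdeal ![g, x] w (w 1) := by
      have h := pow_mul_pow_mem_weightedMonomialIdeal g x w (i := 1) (j := 0) (n := w 1) (by simpa using hw)
      rwa [pow_one, pow_zero, mul_one] at h
    have hx : x ∈ weightedMonomialIdeal ![g, x] w (w 1) := by
      have h := pow_mul_pow_mem_weightedMonomialIdeal g x w (i := 0) (j := 1) (n := w 1) (by simp)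
      rwa [pow_zero, pow_one, one_mul] at h
    rcases Set.mem_insert_iff.mp hy with rfl | hy
    · exact hg
    · rw [Set.mem_singleton_iff.mp hy]
      exact hx

/-- Powers: `y ∈ 𝒥_a ⇒ y^k ∈ 𝒥_{a k}` for the monomial ideals of a weighted chart (multiplicativity). [folklore] -/
theorem pow_mem_weightedMonomialIdeal_mul {m : ℕ} (u : Fin m → S) (w : Fin m → ℕ) {y : S} {a : ℕ}
    (hy : y ∈ weightedMonomialIdeal u w a) (k : ℕ) : y ^ k ∈ weightedMonomialIdeal u w (a * k) := by
  induction k with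
  | zero => rw [pow_zero, mul_zero, weightedMonomialIdeal_zero]; exact Submodule.mem_top
  | succ k ih =>
    rw [pow_succ, Nat.mul_succ]
    exact weightedMonomialIdeal_mul_le u w _ _ (Ideal.mul_mem_mul ih hy)

/-- **(U3)** If `g₁ ∈ (g₂) + 𝔪^m` with `w 0 ≤ w 1 · m`, `x₁ ∈ 𝔪 = (g₂, x₂)` and `w 1 ≤ w 0`, then
`weightedMonomialIdeal ![g₁, x₁] w n ≤ weightedMonomialIdeal ![g₂, x₂] w n` (`g₁` has `g₂`-weight `≥ w 0`, `x₁` has weight `≥ w 1`,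
products add). [cite: AbramovichQuekSchober2025, Thm 3.5 proof (c)] -/
theorem weightedMonomialIdeal_le_of_mem_span_sup_pow [IsLocalRing S] {g₁ x₁ g₂ x₂ : S}
    (hspan : Ideal.span {g₂, x₂} = maximalIdeal S) (w : Fin 2 → ℕ) (hw : w 1 ≤ w 0) {m : ℕ} (hwm : w 0 ≤ w 1 * m)
    (hg₁ : g₁ ∈ Ideal.span {g₂} ⊔ maximalIdeal S ^ m) (hx₁ : x₁ ∈ maximalIdeal S) (n : ℕ) :
    weightedMonomialIdeal ![g₁, x₁] w n ≤ weightedMonomialIdeal ![g₂, x₂] w n := by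
  -- `g₂` has weight `w 0`, so has `g₁`; `x₁ ∈ 𝔪` has weight `≥ w 1`
  have hg₂w : g₂ ∈ weightedMonomialIdeal ![g₂, x₂] w (w 0) := by
    have h := pow_mul_pow_mem_weightedMonomialIdeal g₂ x₂ w (i := 1) (j := 0) (n := w 0) (by simp)
    rwa [pow_one, pow_zero, mul_one] at h
  have hg₁w : g₁ ∈ weightedMonomialIdeal ![g₂, x₂] w (w 0) := by
    obtain ⟨a, ha, r, hr, rfl⟩ := Submodule.mem_sup.mp hg₁
    obtain ⟨c, rfl⟩ := Ideal.mem_span_singleton'.mp ha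
    exact Ideal.add_mem _ (Ideal.mul_mem_left _ _ hg₂w)
      (weightedMonomialIdeal_antitone _ w hwm (maximalIdeal_pow_le_weightedMonomialIdeal_mul hspan w hw m hr))
  have hx₁w : x₁ ∈ weightedMonomialIdeal ![g₂, x₂] w (w 1) := by
    have h := maximalIdeal_pow_le_weightedMonomialIdeal_mul hspan w hw 1 (by rw [pow_one]; exact hx₁)
    rwa [mul_one] at h
  rw [weightedMonomialIdeal, Ideal.span_le]
  rintro _ ⟨α, hα, rfl⟩
  rw [Fin.sum_univ_two] at hα
  simp only [SetLike.mem_coe, Fin.prod_univ_two, Matrix.cons_val_zero, Matrix.cons_val_one]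
  exact weightedMonomialIdeal_antitone _ w hα (weightedMonomialIdeal_mul_le _ w _ _
    (Ideal.mul_mem_mul (pow_mem_weightedMonomialIdeal_mul _ w hg₁w (α 0)) (pow_mem_weightedMonomialIdeal_mul _ w hx₁w (α 1))))

/-- **AQS Theorem 3.5, proof (c) — UNIQUENESS of the lex-maximal centre's filtration, in the tree's vocabulary (clause 9 of
`IsLexMaxWeightedCentreGerm`)**: in a regular local ring, two regular systems of parameters `(g₁, x₁)`, `(g₂, x₂)` (`(gᵢ, xᵢ) = 𝔪`,
`gᵢ ∉ 𝔪²`) and weights `0 < w 1 < w 0` such that `f ∉ 𝔪^{ν+1}` (`ν ≥ 1`) is admissible for BOTH at the level `ℓ = w 0 · ν`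
define the SAME filtration `weightedMonomialIdeal ![g₁, x₁] w = weightedMonomialIdeal ![g₂, x₂] w` — no lex-maximality needed.
[cite: AbramovichQuekSchober2025, Thm 3.5 proof (c)] -/
theorem weightedMonomialIdeal_eq_of_admissible [IsRegularLocalRing S] {g₁ x₁ g₂ x₂ : S}
    (hspan₁ : Ideal.span {g₁, x₁} = maximalIdeal S) (hspan₂ : Ideal.span {g₂, x₂} = maximalIdeal S)
    (hg₁' : g₁ ∉ maximalIdeal S ^ 2) (hg₂' : g₂ ∉ maximalIdeal S ^ 2)
    (w : Fin 2 → ℕ) (hw1 : 0 < w 1) (hs : w 1 < w 0) {f : S} {ν : ℕ} (hν : 1 ≤ ν)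
    (hford : f ∉ maximalIdeal S ^ (ν + 1)) (h₁ : f ∈ weightedMonomialIdeal ![g₁, x₁] w (w 0 * ν))
    (h₂ : f ∈ weightedMonomialIdeal ![g₂, x₂] w (w 0 * ν)) (n : ℕ) :
    weightedMonomialIdeal ![g₁, x₁] w n = weightedMonomialIdeal ![g₂, x₂] w n := by
  classical
  have hg₁ : g₁ ∈ maximalIdeal S := hspan₁ ▸ Ideal.subset_span (by simp)
  have hx₁ : x₁ ∈ maximalIdeal S := hspan₁ ▸ Ideal.subset_span (by simp)
  have hg₂ : g₂ ∈ maximalIdeal S := hspan₂ ▸ Ideal.subset_span (by simp)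
  have hx₂ : x₂ ∈ maximalIdeal S := hspan₂ ▸ Ideal.subset_span (by simp)
  -- `m = ⌈w 0 / w 1⌉`
  have hex : ∃ m, w 0 ≤ w 1 * m := ⟨w 0, Nat.le_mul_of_pos_left _ hw1⟩
  set m := Nat.find hex with hmdef
  have hwm : w 0 ≤ w 1 * m := Nat.find_spec hex
  have hm : w 1 * (m - 1) < w 0 := by
    have hm0 : 0 < m := by
      by_contra h0
      push Not at h0
      have : m = 0 := by omega
      rw [this, mul_zero] at hwm
      omega
    have := Nat.find_min hex (show m - 1 < m by omega)
    omega
  exact le_antisymm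
    (weightedMonomialIdeal_le_of_mem_span_sup_pow hspan₂ w hs.le hwm
      (mem_span_sup_pow_of_mem_weightedMonomialIdeal hg₁ hx₁ hg₂ hg₂' hx₂ w hs hν hford h₁ h₂ hm) hx₁ n)
    (weightedMonomialIdeal_le_of_mem_span_sup_pow hspan₁ w hs.le hwm
      (mem_span_sup_pow_of_mem_weightedMonomialIdeal hg₂ hx₂ hg₁ hg₁' hx₁ w hs hν hford h₂ h₁ hm) hx₂ n)

end AQSHeightTwo

end Summit.ResolutionOfSingularities.ResolutionOfSingularities.Theorems

end
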